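import Literature.AlgebraicGeometry.Motives.BlochSrinivasPrincipleFiniteCoverStepsProofs
import Literature.AlgebraicGeometry.Motives.CyclesBaseChangeProofs
import Literature.AlgebraicGeometry.Motives.SubschemeCyclesPushPullProofs
import Literature.AlgebraicGeometry.Motives.CartierDivisor
import Literature.AlgebraicGeometry.Motives.AlgebraicEquivalenceFlatPullbackFiniteTypeProofs
import Literature.AlgebraicGeometry.Resolution.FiniteSubextensionDescent
import Literature.AlgebraicGeometry.Resolution.ChowLemmaProofs
import HarnessLib

/-!
# The Bloch–Srinivas principle over a finite cover: Bloch's limit argument (proof of step 2)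

Discharge of the named fact
`Literature.AlgebraicGeometry.Motives.Bloch1980_genericFibreRatTrivial_finiteExt`
(`Literature/AlgebraicGeometry/Motives/BlochSrinivasPrincipleFiniteCoverSteps`; S. Bloch,
*Lectures on Algebraic Cycles*, Appendix to Lecture 1, Lemma 1A.3, proof: "The case `K'`
algebraic over `K` follows by a limit argument"; C. Voisin, *Birational invariants and
decomposition of the diagonal*, Prop. 2.2): for the cycle `[𝒲]` of a family `𝒲 ↪ X ×_k T` over a
smooth projective base `T` with function field `F = k(T)`, if `[𝒲_{η_Ω}] ∈ Rat_d(X ×_k Spec Ω)`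
for some ALGEBRAIC extension `Ω ⊇ F`, then `[𝒲_{η_L}] ∈ Rat_d(X ×_k Spec L)` for some FINITE
extension `L ⊇ F` (`Bloch1980_genericFibreRatTrivial_finiteExt_holds`). Everything is proved; no
new named fact is introduced. (Companion of `Motives/BlochSrinivasPrincipleFiniteCoverStepsProofs`,
which discharges step 3, `Voisin2019_genericFibreRatTrivial_spread_holds`.)

## The proof (Bloch's limit argument, against the tree)

Write `X_E = X ×_k Spec E` for the intermediate fields `E` of `Ω / F` (generic fibres of the
family seen over `E`, `Motives/BlochSrinivasPrincipleFiniteCoverSteps`), so that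
`X_Ω = lim_E X_E` over the subextensions finite over `F`, with flat affine surjective transition
maps `r_E : X_Ω → X_E` (base changes of `Spec Ω → Spec E`). The file proves, in this order:

* `flatPullbackFun_cycle`, `flatPullbackFun_injective` — for a flat morphism `r` NOT of finite
  type (such as `r_E`), the coefficient function of `r^*[V]` is that of `[r⁻¹ V]` (Fulton,
  Lemma 1.7.1, as in `baseChange_cycle_eq_cycle_preimage`), and `r^*` is injective on cycles when
  `r` is moreover surjective (a generic point of a component of `r⁻¹(closure {y})` has non-zero
  fibre multiplicity, `isMax_pullback`);
* `ite_ord_sub_mul_eq_of_isDomain`, `divFun_mul_stalkLength_eq_divFun_of_isPullback` — Fulton's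
  Theorem 1.7 / Lemma A.4.1 for a flat `r` and a closed subvariety `W'` whose inverse image
  `W = r⁻¹(W')` is INTEGRAL: `r^*[div_{W'} φ'] = [div_W (ψ φ')]` coefficientwise, `ψ = K(W') → K(W)`
  (the single-component case of `divFun_mul_stalkLength_eq_finsum_of_height_add_coheight`,
  `Motives/CyclesBaseChangeProofs`, proved directly from the dimension formula for flat local
  homomorphisms and `ord_algebraMap_eq_ord_mul_length`);
* `FiniteExtTower.sections_descent_eventually`, `FiniteExtTower.exists_restage` — the limit
  formalism of `Literature/AlgebraicGeometry/Resolution/FiniteSubextensionDescent` (Görtz–Wedhorn I,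
  (10.13), Thm. 10.57, 10.66: towers `M ⊗_{E₀} E` over the subextensions `E` of an algebraic
  `Ω / F` finite over `F`, in the presentation-free interface of that file) complemented by the
  descent of sections of `𝒪` over affine charts (`Γ(p_K⁻¹U) = Γ(U) ⊗_{E₀} Ω`);
* `FiniteExtTower.generator_descent_eventually` — a generator `[div_W φ]` of `Rat_d(M_Ω)` comes
  from every sufficiently large finite stage `E'`: `W'` is the scheme-theoretic image of `W` in
  `M_{E'}` (integral; `W = W' ×_{M_{E'}} M_Ω` once the ideal of `W` has descended,
  `closedSubscheme_descent_eventually`), `φ' = α'/β'` for descended lifts of a fraction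
  representing `φ` on an affine chart, `ψ φ' = φ` by the compatibility of `ψ` with stalk maps,
  and `dim W' = dim W` (`Scheme.height_eq_height_of_length_stalkFiber_ne_top` at the generic point
  of `W`, whose local ring is a field);
* `FiniteExtTower.ratTrivial_descent_eventually` — **the limit argument**: by induction on the
  subgroup `Rat_d(M_Ω)` generated by the `[div_W φ]`, every `c ∈ Rat_d(M_Ω)` is `r'^* c'` for some
  `c' ∈ Rat_d(M_{E'})` at all large finite stages `E'` and all presentations;
* `Bloch1980_genericFibreRatTrivial_finiteExt_holds` — the family case: the tower is
  `X ×_k ptOver T η_E` with `η_E : Spec E → Spec F → T` (`Resolution.fromSpecExtension`), base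
  `E₀ = ⊥`, the squares being cartesian by `isPullback_whiskerLeft`; the descended
  `c' ∈ Rat_d(X_E)` equals `[𝒲_{η_E}]` because both pull back to `[𝒲_{η_Ω}]` along the injective
  `r_E^*`;
* `finiteCover_ratTrivial_of_genericFibreRatTrivialOverAlgExt_holds` — the corollary: Voisin's
  Prop. 2.2 for a single family from rational triviality of the generic fibre over an ALGEBRAIC
  extension of `k(T)`, now unconditional (steps 2 and 3 both discharged, step 3 being
  `Voisin2019_genericFibreRatTrivial_spread_holds` of
  `Motives/BlochSrinivasPrincipleFiniteCoverStepsProofs`).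

## References

* [BlochLectures2010] S. Bloch, Lectures on Algebraic Cycles, 2nd ed., CUP (2010), Appendix to
  Lecture 1, Lemma 1A.3 (proof) (held copy, PDF p. 37).
* [Voisin2019BirationalDiagonal] C. Voisin, Birational invariants and decomposition of the
  diagonal, LN UMI 26 (2019), §2.1, Thm. 2.1 (proof) and Prop. 2.2 (author pdf, p. 30).
* [Fulton1998] W. Fulton, Intersection Theory, 2nd ed. (1998), Lemma 1.7.1, Thm. 1.7, Example
  6.2.9, Lemma A.4.1.
* [GortzWedhorn2020] U. Görtz, T. Wedhorn, Algebraic Geometry I: Schemes, 2nd ed. (2020), (10.13),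
  Thm. 10.57, Thm. 10.66, Prop. 10.75 (1).
-/

noncomputable section

universe u

open CategoryTheory CategoryTheory.Limits AlgebraicGeometry Order TopologicalSpace IsLocalRing

namespace Literature.AlgebraicGeometry.Motives

/-! ### Flat pull-back of coefficient functions along flat morphisms not of finite type -/

section FlatPullbackFun

variable {X Y : Scheme.{u}} (f : X ⟶ Y)

/-- The coefficient function of `f^* c` (by `rfl`). [folklore] -/
theorem flatPullbackFun_def (c : AlgebraicCycle Y ℤ) (x : X) :
    f.flatPullbackFun c x = c (f x) * fundamentalCycleFun (f.fiber (f x)) (f.asFiber x) := rfl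

/-- `f^*` commutes with negation on coefficient functions. [folklore] -/
theorem flatPullbackFun_neg (c : AlgebraicCycle Y ℤ) :
    f.flatPullbackFun (-c) = -f.flatPullbackFun c := by
  funext x
  simp only [flatPullbackFun_def, Function.locallyFinsuppWithin.coe_neg, Pi.neg_apply, neg_mul]

/-- `f^*` commutes with subtraction on coefficient functions. [folklore] -/
theorem flatPullbackFun_sub (c₁ c₂ : AlgebraicCycle Y ℤ) :
    f.flatPullbackFun (c₁ - c₂) = f.flatPullbackFun c₁ - f.flatPullbackFun c₂ := by
  rw [sub_eq_add_neg, flatPullbackFun_add, flatPullbackFun_neg, sub_eq_add_neg]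

variable [Flat f]

/-- **`f^*[V] = [f⁻¹(V)]` on coefficient functions, for `f` flat (not necessarily of finite
type)** (Fulton, *Intersection Theory*, Lemma 1.7.1; the proof of
`baseChange_cycle_eq_cycle_preimage` verbatim: `ℓ(𝒪_{f⁻¹V,w}) = ℓ(𝒪_{V,v}) · ℓ(𝒪_{X_{f x},x})`,
`stalkLength_pullback_eq_mul`). [cite: Fulton1998, Lemma 1.7.1] -/
theorem flatPullbackFun_cycle [IsLocallyNoetherian X] (hZ : locallyFinsupp_fundamentalCycleFun.{u})
    (V : ClosedSubscheme Y) [IsLocallyNoetherian V.carrier] :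
    f.flatPullbackFun (V.cycle hZ) = ⇑((V.preimage f).cycle hZ) := by
  haveI : IsClosedImmersion (pullback.snd V.ι f) := MorphismProperty.pullback_snd _ _ inferInstance
  funext x
  rw [flatPullbackFun_def]
  change (AlgebraicCycle.map V.ι height height (fundamentalCycle V.carrier hZ)) (f x) * _ =
    (AlgebraicCycle.map (pullback.snd V.ι f) height height (fundamentalCycle (pullback V.ι f) hZ)) x
  by_cases hx : x ∈ Set.range (pullback.snd V.ι f)
  · obtain ⟨w, rfl⟩ := hx
    have hv : f (pullback.snd V.ι f w) = V.ι (pullback.fst V.ι f w) := by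
      rw [← Scheme.Hom.comp_apply, ← pullback.condition, Scheme.Hom.comp_apply]
    have h1 : AlgebraicCycle.map V.ι height height (fundamentalCycle V.carrier hZ)
        (f (pullback.snd V.ι f w)) = stalkLength V.carrier (pullback.fst V.ι f w) := by
      rw [hv, map_apply_of_isClosedImmersion]
      rfl
    rw [h1, map_apply_of_isClosedImmersion, fundamentalCycle_apply, fundamentalCycleFun_apply,
      fundamentalCycleFun_apply, stalkLength_pullback_eq_mul f V w]
    push_cast
    ring
  · rw [map_apply_of_notMem_range _ _ _ hx]
    have hx' : f x ∉ Set.range V.ι := by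
      rwa [Scheme.Pullback.range_snd] at hx
    rw [map_apply_of_notMem_range _ _ _ hx', zero_mul]

/-- The multiplicity of the fibre of a flat morphism at a generic point `η` of a component of
`f⁻¹(V)`, `V ⊆ Y` a closed subvariety, is non-zero (`isMax_pullback`). [folklore] -/
theorem fundamentalCycleFun_fiber_ne_zero_of_isMax [IsLocallyNoetherian X] [IsLocallyNoetherian Y]
    (V : ClosedSubvariety Y) (η : ↥(pullback V.ι f)) (hη : IsMax η) :
    fundamentalCycleFun (f.fiber (f (pullback.snd V.ι f η))) (f.asFiber (pullback.snd V.ι f η)) ≠ 0 := by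
  haveI : IsLocallyNoetherian V.carrier := LocallyOfFiniteType.isLocallyNoetherian V.ι
  have h1 := (isMax_pullback f V η hη).1
  have hmul := stalkLength_pullback_eq_mul f V.toClosedSubscheme η
  change stalkLength (pullback V.ι f) η = stalkLength V.carrier (pullback.fst V.ι f η) *
    stalkLength (f.fiber (f (pullback.snd V.ι f η))) (f.asFiber (pullback.snd V.ι f η)) at hmul
  rw [hmul] at h1
  rw [fundamentalCycleFun_apply]
  exact_mod_cast right_ne_zero_of_mul h1

/-- **Flat pull-back along a flat surjective morphism is injective on cycles** (for `X`, `Y`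
locally Noetherian): if `f^* c₁ = f^* c₂` coefficientwise then `c₁ = c₂`. At a point `y` with
`c y ≠ 0` (`c = c₁ - c₂`), a generic point `η` of a component of `f⁻¹(closure {y})` (non-empty as
`f` is surjective) lies over `y` and has non-zero fibre multiplicity (`isMax_pullback`), so
`(f^* c) η = c y · ℓ ≠ 0`. [folklore] -/
theorem flatPullbackFun_injective [Surjective f] [IsLocallyNoetherian X] [IsLocallyNoetherian Y] :
    Function.Injective (f.flatPullbackFun : AlgebraicCycle Y ℤ → X → ℤ) := by
  intro c₁ c₂ h
  rw [← sub_eq_zero]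
  have h0 : f.flatPullbackFun (c₁ - c₂) = 0 := by rw [flatPullbackFun_sub, h, sub_self]
  generalize c₁ - c₂ = c at h0
  ext y
  by_contra hy
  change c y ≠ 0 at hy
  -- the closure `V` of `y` and a generic point `η` of a component of `f⁻¹(V)` over `y`
  let V := ClosedSubvariety.ofPoint Y y
  haveI : IsLocallyNoetherian V.carrier := LocallyOfFiniteType.isLocallyNoetherian V.ι
  obtain ⟨x, hx⟩ := f.surjective y
  have hyV : V.ι (genericPoint V.carrier) = y := ClosedSubvariety.genericPoint_ofPoint y
  obtain ⟨w₀, -, -⟩ := Scheme.Pullback.exists_preimage_pullback (genericPoint V.carrier) x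
    (hyV.trans hx.symm)
  obtain ⟨η, -, hη⟩ := exists_le_isMax w₀
  have hfst : pullback.fst V.ι f η = genericPoint V.carrier := (isMax_pullback f V η hη).2.1
  have hfη : f (pullback.snd V.ι f η) = y := by
    rw [← Scheme.Hom.comp_apply, ← pullback.condition, Scheme.Hom.comp_apply, hfst, hyV]
  have hne := fundamentalCycleFun_fiber_ne_zero_of_isMax f V η hη
  have hy' : c (f (pullback.snd V.ι f η)) ≠ 0 := by rw [hfη]; exact hy
  have h0η := congrFun h0 (pullback.snd V.ι f η)
  rw [flatPullbackFun_def, Pi.zero_apply] at h0η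
  exact hne ((mul_eq_zero.mp h0η).resolve_left hy')

end FlatPullbackFun

/-! ### The local identity for a flat local homomorphism of domains -/

section Local

variable (A B : Type u) [CommRing A] [CommRing B] [IsLocalRing A] [IsLocalRing B] [Algebra A B]
  [IsLocalHom (algebraMap A B)] [Module.Flat A B] [IsDomain A]
  [IsNoetherianRing A] [IsNoetherianRing B]

/-- **The local identity behind Fulton's Theorem 1.7 at a point where `f⁻¹(W)` is integral**:
for a flat local homomorphism `A → B` of Noetherian local rings, `A` a domain (the case of
`ite_ord_sub_mul_eq_finsum` used when `Spec B` is a single component of multiplicity one), and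
nonzero `a, b ∈ A`,
`[dim A = 1] · (ord_A a - ord_A b) · ℓ_B(B/𝔪_A B) = [dim B = 1] · (ord_B a - ord_B b)` in `ℤ`
(lengths read through `ENat.toNat`). Cases: `dim B ≥ 2` (both sides vanish, the fibre
`B/𝔪_A B` having positive dimension when `dim A = 1`, by `dim B = dim A + dim B/𝔪_A B`);
`dim A = 0` (`a`, `b` are units); `dim A = dim B = 1` (Fulton's Lemma A.4.1,
`ord_algebraMap_eq_ord_mul_length`). [cite: Fulton1998, Lemma A.4.1] -/
theorem ite_ord_sub_mul_eq_of_isDomain {a b : A} (ha : a ≠ 0) (hb : b ≠ 0) :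
    (if ringKrullDim A = 1 then ((Ring.ord A a).toNat : ℤ) - (Ring.ord A b).toNat else 0) *
        (Module.length B (B ⧸ (maximalIdeal A).map (algebraMap A B))).toNat =
      (if ringKrullDim B = 1 then
        ((Ring.ord B (algebraMap A B a)).toNat : ℤ) - (Ring.ord B (algebraMap A B b)).toNat else 0) := by
  set I : Ideal B := (maximalIdeal A).map (algebraMap A B) with hI
  have hIle : I ≤ maximalIdeal B := map_maximalIdeal_le (algebraMap A B)
  have hItop : I ≠ ⊤ := fun h ↦ (maximalIdeal.isMaximal B).ne_top (top_le_iff.mp (h ▸ hIle))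
  haveI : Nontrivial (B ⧸ I) := Ideal.Quotient.nontrivial_iff.mpr hItop
  haveI : IsLocalRing (B ⧸ I) := IsLocalRing.of_surjective' (Ideal.Quotient.mk I)
    Ideal.Quotient.mk_surjective
  obtain ⟨nA, hnA⟩ := exists_ringKrullDim_eq_nat A
  obtain ⟨nB, hnB⟩ := exists_ringKrullDim_eq_nat B
  obtain ⟨nF, hnF⟩ := exists_ringKrullDim_eq_nat (B ⧸ I)
  have hform : nB = nA + nF := by
    have h := ringKrullDim_eq_add_of_flat_of_isLocalHom A B
    rw [hnA, hnB, ← hI, hnF] at h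
    exact_mod_cast h
  have hunit_ord : ∀ {c : A}, IsUnit c → Ring.ord B (algebraMap A B c) = 0 := fun hc ↦
    Ring.ord_of_isUnit (hc.map (algebraMap A B))
  by_cases hB1 : nB ≤ 1
  · have hA1 : nA ≤ 1 := by omega
    rcases Nat.le_one_iff_eq_zero_or_eq_one.mp hA1 with hA0 | hA1
    · -- `dim A = 0`: `A` is a field, `a`, `b` are units, all orders vanish
      subst hA0
      haveI : Ring.KrullDimLE 0 A := by rw [Ring.krullDimLE_iff, hnA]
      have hunit : ∀ {c : A}, c ≠ 0 → IsUnit c := fun hc ↦ by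
        obtain ⟨y, hy⟩ := (Ring.KrullDimLE.isField_of_isDomain (R := A)).mul_inv_cancel hc
        exact isUnit_iff_exists_inv.mpr ⟨y, hy⟩
      rw [if_neg (by rw [hnA]; exact_mod_cast Nat.zero_ne_one), zero_mul, hunit_ord (hunit ha),
        hunit_ord (hunit hb)]
      simp
    · -- `dim A = 1`
      subst hA1
      have hnF0 : nF = 0 := by omega
      have hB : nB = 1 := by omega
      subst hnF0 hB
      rw [if_pos (by rw [hnA]; rfl), if_pos (by rw [hnB]; rfl), ord_algebraMap_eq_ord_mul_length,
        ord_algebraMap_eq_ord_mul_length, ENat.toNat_mul, ENat.toNat_mul]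
      push_cast
      ring
  · -- `dim B ≥ 2`: both sides vanish
    rw [if_neg (show ringKrullDim B ≠ 1 by rw [hnB]; exact_mod_cast (by omega : nB ≠ 1))]
    by_cases hA : ringKrullDim A = 1
    · -- then the fibre has positive dimension and infinite length
      rw [hnA] at hA
      have hA' : nA = 1 := by exact_mod_cast hA
      have hF : 1 ≤ nF := by omega
      have hlen : Module.length B (B ⧸ I) = ⊤ := by
        rw [Module.length_eq_of_surjective (S := B) (R := B ⧸ I) (M := B ⧸ I)
          Ideal.Quotient.mk_surjective]
        by_contra hne
        have hfl : IsArtinianRing (B ⧸ I) :=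
          (isFiniteLength_iff_isNoetherian_isArtinian.mp (Module.length_ne_top_iff.mp hne)).2
        have h0 : Ring.KrullDimLE 0 (B ⧸ I) :=
          (isArtinianRing_iff_isNoetherianRing_krullDimLE_zero.mp hfl).2
        rw [Ring.krullDimLE_iff, hnF] at h0
        have : nF ≤ 0 := by exact_mod_cast h0
        omega
      rw [hlen]
      simp
    · rw [if_neg hA, zero_mul]

end Local

/-! ### Flat pull-back of a principal divisor whose inverse image is integral -/

section DivPullback

variable {X Y : Scheme.{u}} (f : X ⟶ Y) [Flat f] (W : ClosedSubvariety X) (W' : ClosedSubvariety Y)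
  [IsLocallyNoetherian W.carrier] [IsLocallyNoetherian W'.carrier]
  (g : W.carrier ⟶ W'.carrier) (hP : IsPullback g W.ι W'.ι f)
  (ψ : W'.carrier.functionField →+* W.carrier.functionField)
  (hψ : ∀ (w : W.carrier) (s : W'.carrier.presheaf.stalk (g w)),
    ψ (algebraMap _ W'.carrier.functionField s) =
      algebraMap _ W.carrier.functionField ((g.stalkMap w).hom s))

include hP in
omit [Flat f] [IsLocallyNoetherian W.carrier] [IsLocallyNoetherian W'.carrier] in
/-- In a cartesian square `W = W' ×_Y X` the immersion `W ↪ X` has image `f⁻¹(W')`. [folklore] -/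
theorem mem_range_ι_iff_of_isPullback (x : X) : x ∈ Set.range W.ι ↔ f x ∈ Set.range W'.ι := by
  constructor
  · rintro ⟨w, rfl⟩
    exact ⟨g w, by rw [← Scheme.Hom.comp_apply, hP.w, Scheme.Hom.comp_apply]⟩
  · rintro ⟨t, ht⟩
    obtain ⟨z, -, hz⟩ := Scheme.Pullback.exists_preimage_pullback t x ht
    refine ⟨hP.isoPullback.inv z, ?_⟩
    rw [← Scheme.Hom.comp_apply, hP.isoPullback_inv_snd, hz]

include hP hψ in
/-- **`f^*[div_{W'} φ] = [div_W (ψ φ)]` when `W = f⁻¹(W') = W' ×_Y X` is INTEGRAL** (Fulton,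
*Intersection Theory*, Thm. 1.7 / Lemma 1.7.2 in the case of a single component of multiplicity
one: `[f⁻¹(D)] = [D']`), for `f : X ⟶ Y` flat (not necessarily of finite type), `W' ⊆ Y` and
`W ⊆ X` closed subvarieties forming a cartesian square with `g : W → W'`, `ψ : K(W') → K(W)`
compatible with the stalk maps of `g`, and `φ ∈ K(W')` nonzero: at every `x ∈ X`,
`ord_{W'}(φ)(f x) · ℓ(𝒪_{X_{f x}, x}) = ord_W(ψ φ)(x)`. Pointwise this is the local identity
`ite_ord_sub_mul_eq_of_isDomain` in the flat local homomorphism `𝒪_{W', g w} → 𝒪_{W, w}`, whose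
fibre ring has the length of the fibre of `f` (`length_quotient_map_maximalIdeal_of_isPullback`,
`length_stalk_fiber`). [cite: Fulton1998, Theorem 1.7] -/
theorem divFun_mul_stalkLength_eq_divFun_of_isPullback {φ : W'.carrier.functionField} (hφ : φ ≠ 0)
    (x : X) :
    W'.divFun φ (f x) * (stalkLength (f.fiber (f x)) (f.asFiber x) : ℤ) = W.divFun (ψ φ) x := by
  classical
  by_cases hx : x ∈ Set.range W.ι
  swap
  · rw [W.divFun_of_notMem_range _ hx, W'.divFun_of_notMem_range _
      (mt (mem_range_ι_iff_of_isPullback f W W' g hP x).mpr hx), zero_mul]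
  obtain ⟨w, rfl⟩ := hx
  haveI : Flat g := MorphismProperty.of_isPullback (P := @Flat) hP.flip inferInstance
  have hfx : f (W.ι w) = W'.ι (g w) := by
    rw [← Scheme.Hom.comp_apply, ← hP.w, Scheme.Hom.comp_apply]
  have hL0 : W'.divFun φ (f (W.ι w)) = Scheme.ord φ (g w) := by rw [hfx, W'.divFun_ι_base]
  rw [hL0, W.divFun_ι_base]
  -- the flat local homomorphism `A = 𝒪_{W', g w} → B = 𝒪_{W, w}`
  let A : Type u := W'.carrier.presheaf.stalk (g w)
  let B : Type u := W.carrier.presheaf.stalk w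
  letI : Algebra A B := ((g.stalkMap w).hom).toAlgebra
  haveI : IsLocalHom (algebraMap A B) := inferInstanceAs (IsLocalHom (g.stalkMap w).hom)
  haveI : Module.Flat A B := Flat.stalkMap g w
  -- `φ = a / b`
  obtain ⟨a, b, hb0, hab⟩ := IsFractionRing.div_surjective (A := A) φ
  have hb : b ≠ 0 := nonZeroDivisors.ne_zero hb0
  have ha : a ≠ 0 := by
    rintro rfl
    exact hφ (by rw [← hab, map_zero, zero_div])
  have hne : ∀ {c : A}, c ≠ 0 → (g.stalkMap w).hom c ≠ 0 := fun hc ↦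
    nonZeroDivisors.ne_zero (algebraMap_mem_nonZeroDivisors A B hc)
  -- the left-hand side
  have hL1 : (Scheme.ord φ (g w) : ℤ) =
      if ringKrullDim A = 1 then ((Ring.ord A a).toNat : ℤ) - (Ring.ord A b).toNat else 0 := by
    by_cases hw : coheight (g w) = 1
    · rw [if_pos (by rw [ringKrullDim_stalk_eq_coheight, hw]; rfl), ← hab]
      exact Scheme.ord_div_algebraMap hw ha hb
    · rw [Scheme.ord_eq_zero_of_coheight_neq_one hw, if_neg]
      rw [ringKrullDim_stalk_eq_coheight]
      exact_mod_cast hw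
  have hL2 : (stalkLength (f.fiber (f (W.ι w))) (f.asFiber (W.ι w)) : ℤ) =
      (Module.length B (B ⧸ (maximalIdeal A).map (algebraMap A B))).toNat := by
    simp only [stalkLength]
    congr 1
    rw [length_stalk_fiber f, ← length_quotient_map_maximalIdeal_of_isPullback hP w]
    rfl
  -- the right-hand side
  have hR : (Scheme.ord (ψ φ) w : ℤ) =
      if ringKrullDim B = 1 then
        ((Ring.ord B (algebraMap A B a)).toNat : ℤ) - (Ring.ord B (algebraMap A B b)).toNat else 0 := by
    by_cases hw : coheight w = 1
    · rw [if_pos (by rw [ringKrullDim_stalk_eq_coheight, hw]; rfl), ← hab]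
      exact Scheme.ord_map_div g ψ w (hψ w) hw (hne ha) (hne hb)
    · rw [Scheme.ord_eq_zero_of_coheight_neq_one hw, if_neg]
      rw [ringKrullDim_stalk_eq_coheight]
      exact_mod_cast hw
  rw [hL1, hL2, hR]
  exact ite_ord_sub_mul_eq_of_isDomain A B ha hb

end DivPullback

/-! ### Germs and stalk maps -/

section Germs

variable {X Y : Scheme.{u}}

/-- The germ of `f.appLE U V e s` at `x ∈ V` is the stalk map of `f` applied to the germ of `s`
at `f x`. [folklore] -/
theorem germ_appLE_apply (f : X ⟶ Y) (U : Y.Opens) (V : X.Opens) (e : V ≤ f ⁻¹ᵁ U) (x : X)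
    (hx : x ∈ V) (s : Γ(Y, U)) :
    X.presheaf.germ V x hx (f.appLE U V e s) = (f.stalkMap x).hom (Y.presheaf.germ U (f x) (e hx) s) := by
  rw [Scheme.Hom.germ_stalkMap_apply, Scheme.Hom.appLE, CommRingCat.comp_apply,
    TopCat.Presheaf.germ_res_apply]

/-- Stalk maps of equal morphisms agree on germs (all casts on the morphism). [folklore] -/
theorem stalkMap_germ_congr {f g : X ⟶ Y} (hfg : f = g) (U : Y.Opens) (x : X) (hx : f x ∈ U)
    (hx' : g x ∈ U) (s : Γ(Y, U)) :
    (f.stalkMap x).hom (Y.presheaf.germ U (f x) hx s) = (g.stalkMap x).hom (Y.presheaf.germ U (g x) hx' s) := by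
  subst hfg; rfl

end Germs

namespace FiniteExtTower

open Literature.AlgebraicGeometry.Resolution

variable {F : Type u} [Field F] {Ω : Type u} [Field Ω] [Algebra F Ω]

/-! ### Generalities on `appLE` -/

/-- `appLE` along equal morphisms, elementwise (all casts on the morphism). [folklore] -/
theorem appLE_congr_apply {X Y : Scheme.{u}} {f g : X ⟶ Y} (h : f = g) (U : Y.Opens) (V : X.Opens)
    (e : V ≤ f ⁻¹ᵁ U) (e' : V ≤ g ⁻¹ᵁ U) (x : Γ(Y, U)) : f.appLE U V e x = g.appLE U V e' x := by
  subst h; rfl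

/-- `(𝟙 X).appLE U U` is the identity on sections. [folklore] -/
theorem id_appLE_apply {X : Scheme.{u}} (U : X.Opens) (x : Γ(X, U)) :
    (𝟙 X : X ⟶ X).appLE U U le_rfl x = x := by
  have h : (𝟙 X : X ⟶ X).appLE U U le_rfl = 𝟙 _ := by
    rw [show (𝟙 X : X ⟶ X).appLE U U le_rfl = (𝟙 X : X ⟶ X).appLE U ((𝟙 X : X ⟶ X) ⁻¹ᵁ U) le_rfl
      from rfl, Scheme.Hom.appLE_eq_app, Scheme.Hom.id_app]
  rw [h, CommRingCat.id_apply]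

/-- `f.appLE` after `g.appLE` is `(f ≫ g).appLE`, elementwise, with the composite replaced by an
equal morphism. [folklore] -/
theorem appLE_appLE_apply_of_comp_eq {X Y Z : Scheme.{u}} (f : X ⟶ Y) (g : Y ⟶ Z) {k : X ⟶ Z}
    (h : f ≫ g = k) (U : Z.Opens) (V : Y.Opens) (W : X.Opens) (e₁ : V ≤ g ⁻¹ᵁ U)
    (e₂ : W ≤ f ⁻¹ᵁ V) (e₃ : W ≤ k ⁻¹ᵁ U) (x : Γ(Z, U)) :
    f.appLE V W e₂ (g.appLE U V e₁ x) = k.appLE U W e₃ x := by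
  subst h
  rw [← CommRingCat.comp_apply, Scheme.Hom.appLE_comp_appLE]

/-! ### Re-staging a presentation over a larger finite stage -/

section Restage

variable {E₀ : IntermediateField F Ω} {M : Scheme.{u}} (m : M ⟶ Spec (.of E₀))
  {MK : Scheme.{u}} {pK : MK ⟶ M} {qK : MK ⟶ Spec (.of Ω)}

/-- **Transition map between two presentations of stages `E' ≤ E''`.** Given cartesian
presentations `(M_{E'}, p', q')` and `(M_{E''}, p'', q'')` of `M ⊗_{E₀} E'` and `M ⊗_{E₀} E''`
and compatible maps `r' : M_K → M_{E'}`, `r'' : M_K → M_{E''}` from a presentation of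
`M ⊗_{E₀} K`, there is a transition map `t : M_{E''} → M_{E'}` over `M`, over
`Spec E'' → Spec E'`, cartesian, and with `r'' ≫ t = r'`. [folklore] -/
theorem exists_restage {E' E'' : IntermediateField F Ω} (hE' : E₀ ≤ E') (hE'' : E₀ ≤ E'') (hle : E' ≤ E'')
    {ME' : Scheme.{u}} {pE' : ME' ⟶ M} {qE' : ME' ⟶ Spec (.of E')}
    (h' : IsPullback pE' qE' m
      (Spec.map (CommRingCat.ofHom (IntermediateField.inclusion hE').toRingHom)))
    {r' : MK ⟶ ME'} (hr'₁ : r' ≫ pE' = pK)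
    (hr'₂ : r' ≫ qE' = qK ≫ Spec.map (CommRingCat.ofHom (algebraMap E' Ω)))
    {ME'' : Scheme.{u}} {pE'' : ME'' ⟶ M} {qE'' : ME'' ⟶ Spec (.of E'')}
    (h'' : IsPullback pE'' qE'' m
      (Spec.map (CommRingCat.ofHom (IntermediateField.inclusion hE'').toRingHom)))
    {r'' : MK ⟶ ME''} (hr''₁ : r'' ≫ pE'' = pK)
    (hr''₂ : r'' ≫ qE'' = qK ≫ Spec.map (CommRingCat.ofHom (algebraMap E'' Ω))) :
    ∃ t : ME'' ⟶ ME', t ≫ pE' = pE'' ∧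
      t ≫ qE' = qE'' ≫ Spec.map (CommRingCat.ofHom (IntermediateField.inclusion hle).toRingHom) ∧
      IsPullback t qE'' qE'
        (Spec.map (CommRingCat.ofHom (IntermediateField.inclusion hle).toRingHom)) ∧
      r'' ≫ t = r' := by
  have w : pE'' ≫ m = (qE'' ≫ Spec.map (CommRingCat.ofHom
      (IntermediateField.inclusion hle).toRingHom)) ≫
      Spec.map (CommRingCat.ofHom (IntermediateField.inclusion hE').toRingHom) := by
    rw [Category.assoc, specLE_comp_specLE, h''.w]
  refine ⟨h'.lift pE'' _ w, h'.lift_fst _ _ _, h'.lift_snd _ _ _, ?_, ?_⟩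
  · refine IsPullback.of_right (h₁₂ := pE') (v₁₃ := m) ?_ (h'.lift_snd _ _ _) h'
    rw [h'.lift_fst, specLE_comp_specLE]
    exact h''
  · apply h'.hom_ext
    · rw [Category.assoc, h'.lift_fst, hr''₁, hr'₁]
    · rw [Category.assoc, h'.lift_snd, reassoc_of% hr''₂, specTo_comp_specLE, hr'₂]

end Restage

/-! ### Descent of sections over affine charts to a finite stage -/

section Sections

variable {E₀ : IntermediateField F Ω} {M : Scheme.{u}} (m : M ⟶ Spec (.of E₀))
  {MK : Scheme.{u}} {pK : MK ⟶ M} {qK : MK ⟶ Spec (.of Ω)}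

/-- **Sections of `𝒪_{M_K}` over the preimage of an affine open of `M` come from a finite stage,
at every larger finite stage and for every presentation** (`Γ(p_K⁻¹U) = Γ(U) ⊗_{E₀} K` and every
element of `K` lies in a finite subextension; Görtz–Wedhorn I, (10.13), Thm. 10.57). For `K / F`
algebraic. [cite: GortzWedhorn2020, Thm. 10.57, p. 325] -/
theorem sections_descent_eventually [Algebra.IsAlgebraic F Ω] [FiniteDimensional F E₀]
    (hK : IsPullback pK qK m (Spec.map (CommRingCat.ofHom (algebraMap E₀ Ω))))
    (U : M.affineOpens) (s : Γ(MK, pK ⁻¹ᵁ (U : M.Opens))) :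
    ∃ E₁ : IntermediateField F Ω, E₀ ≤ E₁ ∧ FiniteDimensional F E₁ ∧
      ∀ E' : IntermediateField F Ω, E₁ ≤ E' → FiniteDimensional F E' →
      ∀ (hE' : E₀ ≤ E') (ME' : Scheme.{u}) (pE' : ME' ⟶ M) (qE' : ME' ⟶ Spec (.of E')),
        IsPullback pE' qE' m (Spec.map (CommRingCat.ofHom (AlgHom.toRingHom
            (IntermediateField.inclusion hE')))) →
        ∀ (r' : MK ⟶ ME') (hr'₁ : r' ≫ pE' = pK),
          r' ≫ qE' = qK ≫ Spec.map (CommRingCat.ofHom (algebraMap E' Ω)) →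
          ∃ s' : Γ(ME', pE' ⁻¹ᵁ (U : M.Opens)),
            r'.appLE (pE' ⁻¹ᵁ (U : M.Opens)) (pK ⁻¹ᵁ (U : M.Opens))
              (by rw [← Scheme.Hom.comp_preimage, hr'₁]) s' = s := by
  classical
  -- transport to the chosen fibre product
  set σ := Spec.map (CommRingCat.ofHom (algebraMap E₀ Ω)) with hσ
  obtain ⟨e, he₁, he₂⟩ : ∃ e : MK ≅ pullback m σ, e.hom ≫ pullback.fst m σ = pK ∧
      e.hom ≫ pullback.snd m σ = qK :=
    ⟨hK.isoPullback, hK.isoPullback_hom_fst, hK.isoPullback_hom_snd⟩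
  have hle₀ : pK ⁻¹ᵁ (U : M.Opens) ≤ e.hom ⁻¹ᵁ (pullback.fst m σ ⁻¹ᵁ (U : M.Opens)) := by
    rw [← Scheme.Hom.comp_preimage, he₁]
  have hle₀' : pullback.fst m σ ⁻¹ᵁ (U : M.Opens) ≤ e.inv ⁻¹ᵁ (pK ⁻¹ᵁ (U : M.Opens)) := by
    rw [← Scheme.Hom.comp_preimage, ← he₁, e.inv_hom_id_assoc]
  let s₀ : Γ(pullback m σ, pullback.fst m σ ⁻¹ᵁ (U : M.Opens)) :=
    e.inv.appLE (pK ⁻¹ᵁ (U : M.Opens)) _ hle₀' s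
  have hs₀ : e.hom.appLE _ _ hle₀ s₀ = s := by
    simp only [s₀]
    rw [appLE_appLE_apply_of_comp_eq e.hom e.inv e.hom_inv_id _ _ _ hle₀' hle₀ le_rfl, id_appLE_apply]
  -- decompose `s₀ = Σ fst*(aᵢ) snd*(bᵢ)` and adjoin the finitely many `bᵢ`
  obtain ⟨ι, _, a, b, hab⟩ := exists_sum_appLE_of_pullback m σ U s₀
  let Λ : Finset Ω := Finset.univ.image fun i => (Scheme.ΓSpecIso (.of Ω)).hom (b i)
  obtain ⟨E₁, hE₁def⟩ : ∃ E₁ : IntermediateField F Ω,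
    E₁ = E₀ ⊔ IntermediateField.adjoin F (Λ : Set Ω) := ⟨_, rfl⟩
  haveI : FiniteDimensional F (IntermediateField.adjoin F (Λ : Set Ω)) :=
    IntermediateField.finiteDimensional_adjoin fun x _ => Algebra.IsIntegral.isIntegral x
  have hΛ : ∀ i, (Scheme.ΓSpecIso (.of Ω)).hom (b i) ∈ E₁ := by
    intro i
    rw [hE₁def]
    apply (le_sup_right : IntermediateField.adjoin F (Λ : Set Ω) ≤ _)
    apply IntermediateField.subset_adjoin
    simp only [Λ, Finset.coe_image, Finset.coe_univ, Set.image_univ, Set.mem_range]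
    exact ⟨i, rfl⟩
  refine ⟨E₁, hE₁def ▸ le_sup_left, hE₁def ▸ IntermediateField.finiteDimensional_sup _ _, ?_⟩
  intro E' hE₁E' _ hE' ME' pE' qE' hsq r' hr'₁ hr'₂
  -- the `bᵢ` come from `Spec E'`
  have hb' : ∀ i, ∃ b' : Γ(Spec (.of E'), ⊤),
      (Spec.map (CommRingCat.ofHom (algebraMap E' Ω))).appLE ⊤ ⊤ le_top b' = b i :=
    fun i => exists_appLE_specTo_eq (b i) (hE₁E' (hΛ i))
  choose b' hb' using hb'
  refine ⟨∑ i, pE'.appLE U (pE' ⁻¹ᵁ U) le_rfl (a i) * qE'.appLE ⊤ (pE' ⁻¹ᵁ U) le_top (b' i), ?_⟩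
  rw [← hs₀, hab, map_sum, map_sum]
  refine Finset.sum_congr rfl fun i _ => ?_
  rw [map_mul, map_mul]
  congr 1
  · rw [appLE_appLE_apply_of_comp_eq r' pE' hr'₁ _ _ _ le_rfl _ le_rfl,
      appLE_appLE_apply_of_comp_eq e.hom (pullback.fst m σ) he₁ _ _ _ le_rfl hle₀ le_rfl]
  · rw [appLE_appLE_apply_of_comp_eq r' qE' hr'₂ _ _ _ le_top _ le_top,
      appLE_appLE_apply_of_comp_eq e.hom (pullback.snd m σ) he₂ _ _ _ le_top hle₀ le_top, ← hb' i,
      appLE_appLE_apply_of_comp_eq qK (Spec.map (CommRingCat.ofHom (algebraMap E' Ω))) rfl ⊤ ⊤ _ le_top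
        le_top le_top]

end Sections

variable {E₀ : IntermediateField F Ω} {M : Scheme.{u}} (m : M ⟶ Spec (.of E₀))
  {MK : Scheme.{u}} {pK : MK ⟶ M} {qK : MK ⟶ Spec (.of Ω)}

/-! ### The transition map of a presentation is a base change of `Spec K → Spec E'` -/

/-- For a presentation `(M_{E'}, p', q')` of a stage and a compatible `r' : M_K → M_{E'}`, the
square `(r', q_K, q', Spec K → Spec E')` is cartesian. [folklore] -/
theorem isPullback_transition (hK : IsPullback pK qK m (Spec.map (CommRingCat.ofHom (algebraMap E₀ Ω))))
    {E' : IntermediateField F Ω} (hE' : E₀ ≤ E') {ME' : Scheme.{u}} {pE' : ME' ⟶ M}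
    {qE' : ME' ⟶ Spec (.of E')}
    (hsq : IsPullback pE' qE' m
      (Spec.map (CommRingCat.ofHom (IntermediateField.inclusion hE').toRingHom)))
    {r' : MK ⟶ ME'} (hr'₁ : r' ≫ pE' = pK)
    (hr'₂ : r' ≫ qE' = qK ≫ Spec.map (CommRingCat.ofHom (algebraMap E' Ω))) :
    IsPullback r' qK qE' (Spec.map (CommRingCat.ofHom (algebraMap E' Ω))) := by
  have big : IsPullback (r' ≫ pE') qK m (Spec.map (CommRingCat.ofHom (algebraMap E' Ω)) ≫
      Spec.map (CommRingCat.ofHom (IntermediateField.inclusion hE').toRingHom)) := by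
    rw [hr'₁, specTo_comp_specLE]
    exact hK
  exact IsPullback.of_right big hr'₂ hsq

/-- A presentation of a stage is locally of finite type over its field. [folklore] -/
theorem locallyOfFiniteType_stage [LocallyOfFiniteType m] {E' : IntermediateField F Ω} (hE' : E₀ ≤ E')
    {ME' : Scheme.{u}} {pE' : ME' ⟶ M} {qE' : ME' ⟶ Spec (.of E')}
    (hsq : IsPullback pE' qE' m
      (Spec.map (CommRingCat.ofHom (IntermediateField.inclusion hE').toRingHom))) :
    LocallyOfFiniteType qE' :=
  MorphismProperty.of_isPullback (P := @LocallyOfFiniteType) hsq inferInstance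

/-! ### Descent of a generator `[div_W φ]` of `Rat_d(M_K)` to a finite stage -/

section Generator

variable [Algebra.IsAlgebraic F Ω] [FiniteDimensional F E₀] [LocallyOfFiniteType m] [QuasiCompact m]

/-- **A generator of `Rat_d(M ⊗_{E₀} K)` comes from a finite stage** (Bloch, *Lectures on
Algebraic Cycles*, Lemma 1A.3, proof: "The case `K'` algebraic over `K` follows by a limit
argument"). For a closed subvariety `W ⊆ M_K` of dimension `d + 1` and `φ ∈ K(W)` nonzero there is
a finite stage `E₁` such that for every finite stage `E' ⊇ E₁`, every cartesian presentation
`(M_{E'}, p', q')` of `M ⊗_{E₀} E'` and every compatible `r' : M_K → M_{E'}`, there are a closed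
subvariety `W' ⊆ M_{E'}` of dimension `d + 1` and `φ' ∈ K(W')` nonzero with
`r'^*[div_{W'} φ'] = [div_W φ]` coefficientwise. Construction: `W'` is the scheme-theoretic image
of `W → M_K → M_{E'}` (integral; `W = W' ×_{M_{E'}} M_K` once the ideal of `W` comes from the
stage, `closedSubscheme_descent_eventually`), and `φ' = α'/β'` for sections `α', β'` of `𝒪_{M_{E'}}`
over the preimage of an affine chart of `M` descending lifts of a fraction representing `φ`
(`sections_descent_eventually`); the identity of divisors is
`divFun_mul_stalkLength_eq_divFun_of_isPullback`, and `dim W' = dim W` by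
`Scheme.height_eq_height_of_length_stalkFiber_ne_top` at the generic point of `W`.
[cite: BlochLectures2010, Lemma 1A.3 (proof)] -/
theorem generator_descent_eventually
    (hK : IsPullback pK qK m (Spec.map (CommRingCat.ofHom (algebraMap E₀ Ω))))
    [IsLocallyNoetherian MK] (W : ClosedSubvariety MK) [IsLocallyNoetherian W.carrier] {d : ℕ}
    (hW : W.dim = d + 1) {φ : W.carrier.functionField} (hφ : φ ≠ 0) :
    ∃ E₁ : IntermediateField F Ω, E₀ ≤ E₁ ∧ FiniteDimensional F E₁ ∧
      ∀ E' : IntermediateField F Ω, E₁ ≤ E' → FiniteDimensional F E' →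
      ∀ (hE' : E₀ ≤ E') (ME' : Scheme.{u}) (pE' : ME' ⟶ M) (qE' : ME' ⟶ Spec (.of E')),
        IsPullback pE' qE' m (Spec.map (CommRingCat.ofHom (AlgHom.toRingHom
            (IntermediateField.inclusion hE')))) →
        ∀ (r' : MK ⟶ ME'), r' ≫ pE' = pK →
          r' ≫ qE' = qK ≫ Spec.map (CommRingCat.ofHom (algebraMap E' Ω)) →
          ∃ (W' : ClosedSubvariety ME') (_ : IsLocallyNoetherian W'.carrier)
            (φ' : W'.carrier.functionField), φ' ≠ 0 ∧ W'.dim = d + 1 ∧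
            ∀ x : MK, r'.flatPullbackFun (W'.div W'.locallyFiniteSupport_divFun_holds φ') x =
              W.divFun φ x := by
  classical
  obtain ⟨hpKaff, _, _⟩ := isAffineHom_flat_surjective_of_isPullback hK
  -- an affine chart `U ∋ p_K(ξ_W)` of `M`, `V = p_K⁻¹ U`, and `φ = α / β` with `α, β` lifted to `V`
  set ξ := genericPoint W.carrier with hξ
  obtain ⟨_, ⟨U, hU, rfl⟩, hξU, -⟩ :=
    M.isBasis_affineOpens.exists_subset_of_mem_open (Set.mem_univ (pK (W.ι ξ))) isOpen_univ
  let V : MK.Opens := pK ⁻¹ᵁ U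
  have hVaff : IsAffineOpen V := hU.preimage pK
  have hξV : ξ ∈ W.ι ⁻¹ᵁ V := hξU
  have hWVaff : IsAffineOpen (W.ι ⁻¹ᵁ V) := hVaff.preimage W.ι
  haveI : Nonempty (W.ι ⁻¹ᵁ V) := ⟨⟨ξ, hξV⟩⟩
  haveI := functionField_isFractionRing_of_isAffineOpen W.carrier (W.ι ⁻¹ᵁ V) hWVaff
  obtain ⟨α, β, hβ, hαβ⟩ := IsFractionRing.div_surjective (A := Γ(W.carrier, W.ι ⁻¹ᵁ V)) φ
  obtain ⟨a, ha⟩ := W.ι.app_surjective V hVaff α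
  obtain ⟨b, hb⟩ := W.ι.app_surjective V hVaff β
  -- descend `a`, `b` and the ideal of `W`
  obtain ⟨E₁, hE₀E₁, hE₁fin, H⟩ := eventually_and (eventually_and
    (sections_descent_eventually m hK ⟨U, hU⟩ a) (sections_descent_eventually m hK ⟨U, hU⟩ b))
    (closedSubscheme_descent_eventually m hK W.ι.ker)
  refine ⟨E₁, hE₀E₁, hE₁fin, fun E' hE₁E' hE'fin hE' ME' pE' qE' hsq r' hr'₁ hr'₂ => ?_⟩
  obtain ⟨⟨Ha, Hb⟩, HW⟩ := H E' hE₁E' hE'fin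
  obtain ⟨a', ha'⟩ := Ha hE' ME' pE' qE' hsq r' hr'₁ hr'₂
  obtain ⟨b', hb'⟩ := Hb hE' ME' pE' qE' hsq r' hr'₁ hr'₂
  obtain ⟨J, hJ⟩ := HW hE' ME' pE' qE' hsq r' hr'₁ hr'₂
  -- the transition map `r'` is a base change of `Spec K → Spec E'`
  have hr' := isPullback_transition m hK hE' hsq hr'₁ hr'₂
  obtain ⟨hr'aff, hr'flat, hr'surj⟩ := isAffineHom_flat_surjective_of_isPullback hr'
  haveI := locallyOfFiniteType_stage m hE' hsq
  haveI : IsLocallyNoetherian ME' := LocallyOfFiniteType.isLocallyNoetherian qE'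
  -- `W'` := the scheme-theoretic image of `W → M_K → M_{E'}`
  haveI : IsIntegral (W.ι ≫ r').image := ChowLemmaProof.isIntegral_image (W.ι ≫ r')
  let W' : ClosedSubvariety ME' := { carrier := (W.ι ≫ r').image, ι := (W.ι ≫ r').imageι }
  haveI : IsLocallyNoetherian W'.carrier := LocallyOfFiniteType.isLocallyNoetherian W'.ι
  let g : W.carrier ⟶ W'.carrier := (W.ι ≫ r').toImage
  have hgι : g ≫ W'.ι = W.ι ≫ r' := (W.ι ≫ r').toImage_imageι
  -- `W = W' ×_{M_{E'}} M_K`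
  have hker : W'.ι.ker.comap r' = W.ι.ker := by
    have h1 : W'.ι.ker = (W.ι.ker).map r' := by
      change (W.ι ≫ r').ker.subschemeι.ker = _
      rw [Scheme.IdealSheafData.ker_subschemeι, Scheme.IdealSheafData.map_ker]
    rw [h1]
    refine le_antisymm (Scheme.IdealSheafData.comap_map_le _ _) ?_
    have gc : GaloisConnection (fun J : ME'.IdealSheafData => J.comap r')
        (fun I : MK.IdealSheafData => I.map r') :=
      fun J I => (Scheme.IdealSheafData.le_map_iff_comap_le).symm
    calc W.ι.ker = J.comap r' := hJ.symm
      _ ≤ ((W.ι.ker).map r').comap r' :=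
        gc.monotone_l (Scheme.IdealSheafData.le_map_iff_comap_le.mpr hJ.le)
  have hP : IsPullback g W.ι W'.ι r' := (isPullback_of_isClosedImmersion W.ι W'.ι g r' hgι.symm hker).flip
  -- the function field map `ψ = g^♯ : K(W') → K(W)`
  have hgen : g ξ = genericPoint W'.carrier := RatFn.genericPoint_eq_of_isDominant g
  obtain ⟨ψ, hψ⟩ := exists_functionField_ringHom g hgen
  -- `φ' = α' / β'`
  let V' : ME'.Opens := pE' ⁻¹ᵁ U
  have hx₀V' : r' (W.ι ξ) ∈ V' := by
    change pE' (r' (W.ι ξ)) ∈ U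
    rwa [← Scheme.Hom.comp_apply, hr'₁]
  have hgξV' : W'.ι (g ξ) ∈ V' := by rwa [← Scheme.Hom.comp_apply, hgι]
  haveI : Nonempty (W'.ι ⁻¹ᵁ V') := ⟨⟨g ξ, hgξV'⟩⟩
  let φ' : W'.carrier.functionField :=
    W'.carrier.germToFunctionField (W'.ι ⁻¹ᵁ V') (W'.ι.app V' a') /
      W'.carrier.germToFunctionField (W'.ι ⁻¹ᵁ V') (W'.ι.app V' b')
  -- `ψ φ' = φ`
  have hVle : V ≤ r' ⁻¹ᵁ V' := by
    change pK ⁻¹ᵁ U ≤ r' ⁻¹ᵁ (pE' ⁻¹ᵁ U)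
    rw [← Scheme.Hom.comp_preimage, hr'₁]
  have key : ∀ (s : Γ(MK, V)) (s' : Γ(ME', V')), r'.appLE V' V hVle s' = s →
      ψ (W'.carrier.germToFunctionField (W'.ι ⁻¹ᵁ V') (W'.ι.app V' s')) =
        W.carrier.germToFunctionField (W.ι ⁻¹ᵁ V) (W.ι.app V s) := by
    intro s s' hs
    -- both sides are the image of the germ of `s'` at `r' (ι ξ)` under `ι^♯ ∘ r'^♯`
    have h1 : W'.carrier.germToFunctionField (W'.ι ⁻¹ᵁ V') (W'.ι.app V' s') =
        algebraMap (W'.carrier.presheaf.stalk (g ξ)) _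
          ((W'.ι.stalkMap (g ξ)).hom (ME'.presheaf.germ V' (W'.ι (g ξ)) hgξV' s')) := by
      rw [← Scheme.algebraMap_germ_eq_germToFunctionField (x := g ξ) (hx := hgξV'),
        Scheme.Hom.germ_stalkMap_apply]
    have h2 : W.carrier.germToFunctionField (W.ι ⁻¹ᵁ V) (W.ι.app V s) =
        @algebraMap (W.carrier.presheaf.stalk ξ) _ _ _ (stalkFunctionFieldAlgebra W.carrier ξ)
          ((W.ι.stalkMap ξ).hom (MK.presheaf.germ V (W.ι ξ) hξV s)) := by
      rw [← Scheme.algebraMap_germ_eq_germToFunctionField (x := ξ) (hx := hξV),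
        Scheme.Hom.germ_stalkMap_apply]
    have h3 : (g.stalkMap ξ).hom ((W'.ι.stalkMap (g ξ)).hom
        (ME'.presheaf.germ V' (W'.ι (g ξ)) hgξV' s')) =
        ((g ≫ W'.ι).stalkMap ξ).hom (ME'.presheaf.germ V' ((g ≫ W'.ι) ξ) hgξV' s') := by
      rw [Scheme.Hom.stalkMap_comp]
      rfl
    have h4 : (W.ι.stalkMap ξ).hom ((r'.stalkMap (W.ι ξ)).hom
        (ME'.presheaf.germ V' (r' (W.ι ξ)) (hVle hξV) s')) =
        ((W.ι ≫ r').stalkMap ξ).hom (ME'.presheaf.germ V' ((W.ι ≫ r') ξ) (hVle hξV) s') := by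
      rw [Scheme.Hom.stalkMap_comp]
      rfl
    rw [h1, hψ, h2, ← hs, germ_appLE_apply, h3, h4, stalkMap_germ_congr hgι V' ξ hgξV' (hVle hξV) s']
  have hψφ' : ψ φ' = φ := by
    simp only [φ']
    rw [map_div₀, key a a' ha', key b b' hb', ha, hb]
    exact hαβ
  have hφ' : φ' ≠ 0 := by
    rintro h
    rw [h, map_zero] at hψφ'
    exact hφ hψφ'.symm
  -- `dim W' = dim W`
  have hdim : W'.dim = d + 1 := by
    have hgen' : W'.genericPoint = r' (W.ι ξ) := by
      change W'.ι (genericPoint W'.carrier) = _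
      rw [← hgen, ← Scheme.Hom.comp_apply, hgι, Scheme.Hom.comp_apply]
    -- the fibre of `r'` at the generic point of `W` has finite length (`𝒪_{W,ξ}` is a field)
    have hlen : Module.length ((r'.fiber (r' (W.ι ξ))).presheaf.stalk (r'.asFiber (W.ι ξ)))
        ((r'.fiber (r' (W.ι ξ))).presheaf.stalk (r'.asFiber (W.ι ξ))) ≠ ⊤ := by
      rw [length_stalk_fiber r', ← length_quotient_map_maximalIdeal_of_isPullback hP ξ]
      have h0 : coheight ξ = 0 := by
        rw [Order.coheight_eq_zero]
        intro b _
        exact Scheme.le_iff_specializes.2 ((genericPoint_spec W.carrier).specializes (Set.mem_univ b))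
      haveI : Ring.KrullDimLE 0 (W.carrier.presheaf.stalk ξ) := by
        rw [Ring.krullDimLE_iff, ringKrullDim_stalk_eq_coheight, h0]
        rfl
      haveI : IsArtinianRing (W.carrier.presheaf.stalk ξ) :=
        isArtinianRing_iff_isNoetherianRing_krullDimLE_zero.mpr ⟨inferInstance, inferInstance⟩
      exact Module.length_ne_top
    change height W'.genericPoint = _
    rw [hgen', ← Scheme.height_eq_height_of_length_stalkFiber_ne_top (algebraMap E' Ω) qE' r' qK
      hr' (W.ι ξ) hlen]
    exact hW
  refine ⟨W', inferInstance, φ', hφ', hdim, fun x => ?_⟩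
  haveI := hr'flat
  rw [Scheme.Hom.flatPullbackFun, ClosedSubvariety.div_apply, fundamentalCycleFun_apply,
    divFun_mul_stalkLength_eq_divFun_of_isPullback r' W W' g hP ψ hψ hφ' x, hψφ']

end Generator

section Descent

variable [Algebra.IsAlgebraic F Ω] [FiniteDimensional F E₀] [LocallyOfFiniteType m] [QuasiCompact m]

/-! ### Descent of rational triviality to a finite stage (Bloch's limit argument) -/

/-- **`Rat_d(M ⊗_{E₀} K) = ⋃_{E'} (transition)^* Rat_d(M ⊗_{E₀} E')` over the finite stages
`E'` of the algebraic extension `K`** (Bloch, *Lectures on Algebraic Cycles*, Lemma 1A.3, proof: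
"The case `K'` algebraic over `K` follows by a limit argument"; the cycle-level content of
`CH(X_{K'}) = colim_L CH(X_L)`): every `c ∈ Rat_d(M_K)` is, at all sufficiently large finite
stages `E'` and for every cartesian presentation of `M ⊗_{E₀} E'` with a compatible
`r' : M_K → M_{E'}`, the flat pull-back `r'^* c'` of some `c' ∈ Rat_d(M_{E'})` (coefficientwise).
Proof: induction on the subgroup generated by the `[div_W φ]` (`generator_descent_eventually` for
the generators, finite stages being directed). [cite: BlochLectures2010, Lemma 1A.3 (proof)] -/
theorem ratTrivial_descent_eventually
    (hK : IsPullback pK qK m (Spec.map (CommRingCat.ofHom (algebraMap E₀ Ω))))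
    [IsLocallyNoetherian MK] {d : ℕ} {c : AlgebraicCycle MK ℤ} (hc : c ∈ ratTrivial MK d) :
    ∃ E₁ : IntermediateField F Ω, E₀ ≤ E₁ ∧ FiniteDimensional F E₁ ∧
      ∀ E' : IntermediateField F Ω, E₁ ≤ E' → FiniteDimensional F E' →
      ∀ (hE' : E₀ ≤ E') (ME' : Scheme.{u}) (pE' : ME' ⟶ M) (qE' : ME' ⟶ Spec (.of E')),
        IsPullback pE' qE' m (Spec.map (CommRingCat.ofHom (AlgHom.toRingHom
            (IntermediateField.inclusion hE')))) →
        ∀ (r' : MK ⟶ ME'), r' ≫ pE' = pK →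
          r' ≫ qE' = qK ≫ Spec.map (CommRingCat.ofHom (algebraMap E' Ω)) →
          ∃ c' ∈ ratTrivial ME' d, r'.flatPullbackFun c' = ⇑c := by
  induction hc using AddSubgroup.closure_induction with
  | mem c hc =>
    obtain ⟨-, W, hWN, φ, hφ, hW, hcW⟩ := hc
    haveI := hWN
    obtain ⟨E₁, h₁, h₂, H⟩ := generator_descent_eventually m hK W hW hφ
    refine ⟨E₁, h₁, h₂, fun E' hE₁ hfin hE' ME' pE' qE' hsq r' hr'₁ hr'₂ => ?_⟩
    obtain ⟨W', hW'N, φ', hφ', hdim, hdiv⟩ := H E' hE₁ hfin hE' ME' pE' qE' hsq r' hr'₁ hr'₂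
    haveI : LocallyOfFiniteType (Over.mk qE' : SchemeOver E').hom := locallyOfFiniteType_stage m hE' hsq
    refine ⟨W'.div W'.locallyFiniteSupport_divFun_holds φ', AddSubgroup.subset_closure
      ⟨?_, W', hW'N, φ', hφ', hdim, rfl⟩, ?_⟩
    · exact divFun_mem_cyclesOfDim_holds (Over.mk qE' : SchemeOver E') W' hdim hφ' _ rfl
    · funext x
      rw [hdiv x, hcW]
  | zero =>
    refine ⟨E₀, le_rfl, inferInstance, fun E' _ _ hE' ME' pE' qE' hsq r' hr'₁ hr'₂ => ?_⟩
    exact ⟨0, zero_mem _, by rw [flatPullbackFun_zero]; rfl⟩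
  | add c₁ c₂ _ _ h₁ h₂ =>
    obtain ⟨E₁, hE₁, hfin₁, H⟩ := eventually_and h₁ h₂
    refine ⟨E₁, hE₁, hfin₁, fun E' hE₁E' hfin hE' ME' pE' qE' hsq r' hr'₁ hr'₂ => ?_⟩
    obtain ⟨H₁, H₂⟩ := H E' hE₁E' hfin
    obtain ⟨c₁', hc₁', h₁'⟩ := H₁ hE' ME' pE' qE' hsq r' hr'₁ hr'₂
    obtain ⟨c₂', hc₂', h₂'⟩ := H₂ hE' ME' pE' qE' hsq r' hr'₁ hr'₂
    refine ⟨c₁' + c₂', add_mem hc₁' hc₂', ?_⟩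
    rw [flatPullbackFun_add, h₁', h₂']
    rfl
  | neg c _ h =>
    obtain ⟨E₁, hE₁, hfin₁, H⟩ := h
    refine ⟨E₁, hE₁, hfin₁, fun E' hE₁E' hfin hE' ME' pE' qE' hsq r' hr'₁ hr'₂ => ?_⟩
    obtain ⟨c', hc', h'⟩ := H E' hE₁E' hfin hE' ME' pE' qE' hsq r' hr'₁ hr'₂
    refine ⟨-c', neg_mem hc', ?_⟩
    rw [flatPullbackFun_neg, h']
    rfl

end Descent

end FiniteExtTower

/-! ### The family setting: generic fibres over the subextensions of `Ω ⊇ k(T)` -/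

section Family

open MonoidalCategory CartesianMonoidalCategory

variable {k : Type u} [Field k] {X T : SchemeOver k} [IsIntegral T.left]

/-- The `T`-point `η_L : Spec L → Spec k(T) → T` of an extension `L ⊇ k(T)` factors through
`η_{L'}` along a `k(T)`-algebra map `L' → L`: `Spec L → Spec L' → T` is `η_L`. [folklore] -/
theorem specMap_comp_fromSpecExtension {L L' : Type u} [Field L] [Field L']
    [Algebra T.left.functionField L] [Algebra T.left.functionField L'] (f : L' →+* L)
    (hf : f.comp (algebraMap T.left.functionField L') = algebraMap T.left.functionField L) :
    Spec.map (CommRingCat.ofHom f) ≫ Resolution.fromSpecExtension T.left L' =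
      Resolution.fromSpecExtension T.left L := by
  simp only [Resolution.fromSpecExtension]
  rw [← Category.assoc, ← Spec.map_comp, ← CommRingCat.ofHom_comp]
  exact congrArg (fun g : T.left.functionField →+* L =>
    Spec.map (CommRingCat.ofHom g) ≫ Resolution.fromSpecFunctionField T.left) hf

/-- **The `T`-morphism `ptOver T η_L → ptOver T η_{L'}` of a `k(T)`-algebra map `L' → L`**: a
morphism over `T` with underlying morphism `Spec L → Spec L'` (stated as an existence, which is
all that is used). [folklore] -/
theorem exists_ptOverHom {L L' : Type u} [Field L] [Field L'] [Algebra T.left.functionField L]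
    [Algebra T.left.functionField L'] (f : L' →+* L)
    (hf : f.comp (algebraMap T.left.functionField L') = algebraMap T.left.functionField L) :
    ∃ g : ptOver T (Resolution.fromSpecExtension T.left L) ⟶
        ptOver T (Resolution.fromSpecExtension T.left L'),
      g.left = Spec.map (CommRingCat.ofHom f) ∧
      g ≫ ptOverι T (Resolution.fromSpecExtension T.left L') =
        ptOverι T (Resolution.fromSpecExtension T.left L) := by
  refine ⟨Over.homMk (Spec.map (CommRingCat.ofHom f)) ?_, rfl, ?_⟩
  · change Spec.map _ ≫ Resolution.fromSpecExtension T.left L' ≫ T.hom =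
      Resolution.fromSpecExtension T.left L ≫ T.hom
    rw [← Category.assoc, specMap_comp_fromSpecExtension f hf]
  · ext : 1
    exact specMap_comp_fromSpecExtension f hf

end Family

/-! ### The discharge of `Bloch1980_genericFibreRatTrivial_finiteExt` -/

open MonoidalCategory CartesianMonoidalCategory in
/-- **Step 2 of the printed proof of Voisin 2019, Prop. 2.2 — Bloch's "limit argument"
(Bloch, *Lectures on Algebraic Cycles*, Lemma 1A.3, proof: "The case `K'` algebraic over `K`
follows by a limit argument") — discharging the named fact
`Bloch1980_genericFibreRatTrivial_finiteExt`**: if the generic fibre cycle `[𝒲_{η_Ω}]` of a family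
`𝒲 ↪ X ×_k T` is rationally trivial over some ALGEBRAIC extension `Ω ⊇ k(T)`, then `[𝒲_{η_L}]` is
rationally trivial for some FINITE extension `L ⊇ k(T)`. Proof: the finitely many subvarieties
and rational functions exhibiting `[𝒲_{η_Ω}] ∈ Rat_d(X ×_k Spec Ω)` come from a finite
subextension `L = E ⊆ Ω` (`FiniteExtTower.ratTrivial_descent_eventually`, for the tower
`X ×_k Spec E → X ×_k Spec ⊥` of base changes of the generic fibre over the intermediate fields of
`Ω / k(T)`), where the same identity holds because the flat pull-back along
`X ×_k Spec Ω → X ×_k Spec E` is injective on cycles (`flatPullbackFun_injective`) and maps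
`[𝒲_{η_E}]` to `[𝒲_{η_Ω}]` (`flatPullbackFun_cycle`). [cite: BlochLectures2010, Lemma 1A.3 (proof)]
[cite: Voisin2019BirationalDiagonal, Prop. 2.2] -/
theorem Bloch1980_genericFibreRatTrivial_finiteExt_holds :
    Bloch1980_genericFibreRatTrivial_finiteExt.{u} := by
  intro k _ e X T _ _ _ _ hT 𝒲 _ _ hZ d _ hgen
  haveI : IsIntegral T.left := IsSmoothProjective.isIntegral_holds hT
  obtain ⟨Ω, _, _, halg, hΩ⟩ := hgen
  haveI := halg
  set F := T.left.functionField
  -- the tower of generic fibres `X_E = X ×_k Spec E` over the intermediate fields `E` of `Ω / F`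
  let η : ∀ (L : Type u) [Field L] [Algebra F L], Spec (.of L) ⟶ T.left :=
    fun L _ _ => Resolution.fromSpecExtension T.left L
  let P : ∀ (L : Type u) [Field L] [Algebra F L], SchemeOver k := fun L _ _ => ptOver T (η L)
  let E₀ : IntermediateField F Ω := ⊥
  -- the `T`-morphisms `P Ω → P E`, `P E' → P E`
  have hΩE : ∀ E : IntermediateField F Ω,
      (algebraMap E Ω).comp (algebraMap F E) = algebraMap F Ω := fun E =>
    (IsScalarTower.algebraMap_eq F E Ω).symm
  have hEE : ∀ {E E' : IntermediateField F Ω} (h : E ≤ E'),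
      (IntermediateField.inclusion h).toRingHom.comp (algebraMap F E) = algebraMap F E' := fun h =>
    (IntermediateField.inclusion h).comp_algebraMap
  have hgΩ : ∀ E : IntermediateField F Ω, ∃ g : P Ω ⟶ P E,
      g.left = Spec.map (CommRingCat.ofHom (algebraMap E Ω)) ∧
      g ≫ ptOverι T (η E) = ptOverι T (η Ω) := fun E => exists_ptOverHom (algebraMap E Ω) (hΩE E)
  choose gΩ hgΩl hgΩι using hgΩ
  have hgLE : ∀ (E E' : IntermediateField F Ω) (h : E ≤ E'), ∃ g : P E' ⟶ P E,
      g.left = Spec.map (CommRingCat.ofHom (IntermediateField.inclusion h).toRingHom) ∧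
      g ≫ ptOverι T (η E) = ptOverι T (η E') := fun E E' h =>
    exists_ptOverHom (IntermediateField.inclusion h).toRingHom (hEE h)
  choose gLE hgLEl _ using hgLE
  -- the presentation of the tower: base `M = X_⊥`, `M_K = X_Ω`
  let M : Scheme.{u} := (X ⊗ P E₀).left
  let m : M ⟶ Spec (.of E₀) := (snd X (P E₀)).left
  haveI : LocallyOfFiniteType m := inferInstanceAs (LocallyOfFiniteType (pullback.snd X.hom _))
  haveI : QuasiCompact m := inferInstanceAs (QuasiCompact (pullback.snd X.hom _))
  have hK : IsPullback (X ◁ gΩ E₀).left (snd X (P Ω)).left m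
      (Spec.map (CommRingCat.ofHom (algebraMap E₀ Ω))) := by
    rw [← hgΩl E₀]
    exact isPullback_whiskerLeft X (gΩ E₀)
  -- the descent
  obtain ⟨E₁, -, hfin, H⟩ := FiniteExtTower.ratTrivial_descent_eventually m hK hΩ
  haveI := hfin
  have hsq : IsPullback (X ◁ gLE E₀ E₁ bot_le).left (snd X (P E₁)).left m
      (Spec.map (CommRingCat.ofHom (IntermediateField.inclusion (bot_le : E₀ ≤ E₁)).toRingHom)) := by
    rw [← hgLEl E₀ E₁ bot_le]
    exact isPullback_whiskerLeft X (gLE E₀ E₁ bot_le)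
  have hr₁ : (X ◁ gΩ E₁).left ≫ (X ◁ gLE E₀ E₁ bot_le).left = (X ◁ gΩ E₀).left := by
    rw [← Over.comp_left, ← MonoidalCategory.whiskerLeft_comp]
    congr 2
    ext : 1
    rw [Over.comp_left, hgΩl, hgLEl, hgΩl]
    exact Resolution.specTo_comp_specLE (bot_le : E₀ ≤ E₁)
  have hr₂ : (X ◁ gΩ E₁).left ≫ (snd X (P E₁)).left =
      (snd X (P Ω)).left ≫ Spec.map (CommRingCat.ofHom (algebraMap E₁ Ω)) := by
    rw [← Over.comp_left, whiskerLeft_snd, Over.comp_left, hgΩl]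
    rfl
  obtain ⟨c', hc', hc'c⟩ := H E₁ le_rfl hfin bot_le _ _ _ hsq _ hr₁ hr₂
  -- `r^*[𝒲_{η_E}] = [𝒲_{η_Ω}]`, so `c' = [𝒲_{η_E}]` by injectivity
  set r := (X ◁ gΩ E₁).left with hr
  have hr' := FiniteExtTower.isPullback_transition m hK bot_le hsq hr₁ hr₂
  obtain ⟨_, hrflat, hrsurj⟩ := Resolution.isAffineHom_flat_surjective_of_isPullback hr'
  have hcyc : r.flatPullbackFun ((familyFiberOver 𝒲 (η E₁)).cycle hZ) =
      ⇑((familyFiberOver 𝒲 (η Ω)).cycle hZ) := by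
    rw [flatPullbackFun_cycle r hZ]
    congr 1
    have h : r ≫ (X ◁ ptOverι T (η E₁)).left = (X ◁ ptOverι T (η Ω)).left := by
      rw [hr, ← Over.comp_left, ← MonoidalCategory.whiskerLeft_comp, hgΩι]
    refine ClosedSubscheme.cycle_eq_of_iso _ _
      (pullbackLeftPullbackSndIso 𝒲.ι (X ◁ ptOverι T (η E₁)).left r ≪≫ pullback.congrHom rfl h) ?_ hZ
    change (_ ≫ _) ≫ pullback.snd _ _ =
      pullback.snd (pullback.snd 𝒲.ι (X ◁ ptOverι T (η E₁)).left) r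
    rw [Category.assoc, pullback.congrHom_hom, pullback.lift_snd, Category.comp_id]
    exact pullbackLeftPullbackSndIso_hom_snd _ _ _
  have hc'eq : c' = (familyFiberOver 𝒲 (η E₁)).cycle hZ :=
    flatPullbackFun_injective r (hc'c.trans hcyc.symm)
  refine ⟨E₁, inferInstance, inferInstance, hfin, ?_⟩
  change (familyFiberOver 𝒲 (η E₁)).cycle hZ ∈ ratTrivial _ d
  rw [← hc'eq]
  exact hc'

open MonoidalCategory in
/-- **Voisin 2019, Prop. 2.2 for a single family from "`Z` vanishes in `CH(Y_{η_Ω})`", `Ω`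
ALGEBRAIC over `k(T)` — now unconditional.** The assembly
`finiteCover_ratTrivial_of_genericFibreRatTrivialOverAlgExt` of
`Motives/BlochSrinivasPrincipleFiniteCoverSteps` fed with the two discharged steps
(`Bloch1980_genericFibreRatTrivial_finiteExt_holds`, this file, and
`Voisin2019_genericFibreRatTrivial_spread_holds`, `Motives/BlochSrinivasPrincipleFiniteCoverStepsProofs`):
over any field `k`, for `T` smooth projective of dimension `e`, `X` a `k`-variety,
`𝒲 ↪ X × T` closed and flat over `T` with `[𝒲]` of dimension `d + e`, if
`[𝒲_{η_Ω}] ∈ Rat_d(X ×ₖ Spec Ω)` for some algebraic extension `Ω ⊇ k(T)`, then there are a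
non-empty open `U ⊆ T` and a finite flat `p : U' → U` of constant positive degree such that the
flat pull-back to `U' ×_U (X × U)` of `Z_{|X × U}` lies in `Rat_{d+e}`. (What remains of the
complex target `Voisin2019_fibrewiseRatTrivial_finiteCover` is its first sentence: complex-point
hypothesis ⇒ `GenericFibreRatTrivialOverAlgExt`, by models over a countable subfield and Vial's
Lemma 2.1; see the module docstring of the Steps file.)
[cite: Voisin2019BirationalDiagonal, Thm. 2.1 (proof) and Prop. 2.2]
[cite: BlochLectures2010, Lemma 1A.3 (proof)] -/
theorem finiteCover_ratTrivial_of_genericFibreRatTrivialOverAlgExt_holds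
    {k : Type u} [Field k] {e : ℕ} {X T : SchemeOver k} [LocallyOfFiniteType X.hom]
    [QuasiCompact X.hom] [IsIntegral X.left] [IsLocallyNoetherian X.left]
    (hT : IsSmoothProjective e T) (𝒲 : ClosedSubscheme (X ⊗ T).left)
    [IsLocallyNoetherian 𝒲.carrier] [Flat (𝒲.ι ≫ (CartesianMonoidalCategory.snd X T).left)]
    (hZ : locallyFinsupp_fundamentalCycleFun.{u}) (hf : locallyFinsupp_flatPullbackFun.{u}) (d : ℕ)
    (hdim : 𝒲.cycle hZ ∈ cyclesOfDim (X ⊗ T).left (d + e))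
    (hgen : haveI : IsIntegral T.left := IsSmoothProjective.isIntegral_holds hT
      GenericFibreRatTrivialOverAlgExt 𝒲 hZ d) :
    ∃ U : T.left.Opens, (U : Set T.left).Nonempty ∧
      ∃ (U' : Scheme.{u}) (p : U' ⟶ (U : Scheme.{u})) (_ : IsFinite p) (_ : Flat p),
        (∃ N : ℕ, 0 < N ∧ ∀ u : U, p.finrank u = N) ∧
        flatPullback (pullback.fst ((CartesianMonoidalCategory.snd X T).left ∣_ U) p) hf
            (flatPullback ((CartesianMonoidalCategory.snd X T).left ⁻¹ᵁ U).ι hf (𝒲.cycle hZ)) ∈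
          ratTrivial (pullback ((CartesianMonoidalCategory.snd X T).left ∣_ U) p) (d + e) :=
  finiteCover_ratTrivial_of_genericFibreRatTrivialOverAlgExt
    @Bloch1980_genericFibreRatTrivial_finiteExt_holds @Voisin2019_genericFibreRatTrivial_spread_holds
    hT 𝒲 hZ hf d hdim hgen

end Literature.AlgebraicGeometry.Motives

end
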